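import Summits.CriticalPhenomena.PercolationContinuityZ3.Theorems.Transplant.FKConnectivityAllQSPWagner
import HarnessLib

/-!
# Connectivity correlation inequalities for `φ_{w,q}`, every `q > 0` — file 17: RE-ROOTING a two-terminal series–parallel network at any
# of its edges, and Wagner's theorem for ALL pairs of a 2-connected series–parallel support

Support file (`--supports stmt-CriticalPhenomena-4575`), FK sub-lane `prim-bschramm-fk-2` (gen 7) of the post-continuity
programme; builds on p205010 (kernel theorem, internal audit signed; external expert review pending).  No definitions, no named
facts, no sorries; standard axioms.

`…AllQSPWagner.lean` proves EC⁺ / edge-negative association for the TERMINAL pair of a two-terminal series–parallel network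
(`FK.IsTTSP E s t`).  Here the decomposition is re-rooted:
* `FK.IsTTSP.reroot` — if `E` is TTSP between `s, t`, `N` is another TTSP network between `s, t` meeting `E` only in `{s, t}`, and
  `xy ∈ E`, then `E ∪ N` is TTSP between `x` and `y` (induction on `E`: across a series node the sibling and `N` are composed in series
  around the far side, across a parallel node in parallel);
* `FK.IsTTSP.reroot_of_mem` — if moreover the terminal edge `st` lies in `E`, then `E ∪ N` (and `E` itself, `N = ∅`) is TTSP between the
  endpoints of every edge of `E`;
* `FK.IsTTSP.insert_edge_of_mem` — hence `E ∪ {st}` is TTSP between the endpoints of EACH of its edges: a 2-connected series–parallel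
  graph presented as 'terminal edge ∥ network' (Duffin 1965) can be re-presented at any edge.
Consequences (`w` supported in `E ∪ {st}`): **`FK.edgeNegCorr_supp_of_isTTSP`** — for `0 < q < 1`, `φ_{w,q}` is edge-negatively associated
for ALL pairs `e ≠ f` (`e` not a loop): Wagner 2008 (graph case) in exactly the shape of the hypothesis `hNC` of
`FK.pairConnPosUnder_of_edgeNegCorr_on` / of the named fact `Wagner2008_rc_edgeNegCorr_of_noK4Minor` with '`K₄`-minor-free' replaced by
'inside a terminal-edge-completed two-terminal series–parallel network' (`…_of_le_one`: the range `0 < q ≤ 1`); and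
**`FK.edgeConnMono_of_isTTSP_mem`** — EC⁺ at the endpoints of every
edge of `E ∪ {st}`, every `q > 0`.
[cite: Wagner2006, Ex. 5.1, Thm. 5.8(d), §5.3] [cite: Grimmett2006, §3.9 eq. (3.94) (pp. 63–64)]
-/

noncomputable section

namespace Summit.CriticalPhenomena.PercolationContinuityZ3.Theorems

namespace FK

open MeasureTheory Literature.Probability.LatticeModels Literature.Probability.Percolation
open Literature.Probability.Percolation.DecisionTree (ind ind_of_mem ind_of_not_mem ind_nonneg)
open scoped Classical

variable {V : Type*}

/-! ### Re-rooting -/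

section Reroot

/-- Spanned vertices of a union. [folklore] -/
theorem span_union {A B : Finset (Sym2 V)} {z : V} (h : ∃ e ∈ A ∪ B, z ∈ e) : (∃ e ∈ A, z ∈ e) ∨ (∃ e ∈ B, z ∈ e) := by
  obtain ⟨e, he, hze⟩ := h
  rcases Finset.mem_union.1 he with he | he
  · exact Or.inl ⟨e, he, hze⟩
  · exact Or.inr ⟨e, he, hze⟩

/-- **Re-rooting at an edge, with a network across the terminals**: `E` TTSP between `s, t`, `N` TTSP between `s, t`, edge-disjoint,
spanned vertex sets meeting inside `{s, t}`, `xy ∈ E` ⇒ `E ∪ N` is TTSP between `x` and `y`. [folklore] -/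
theorem IsTTSP.reroot {E : Finset (Sym2 V)} {s t : V} (hE : IsTTSP E s t) :
    ∀ {N : Finset (Sym2 V)} {x y : V}, IsTTSP N s t → Disjoint E N →
      (∀ z : V, (∃ e ∈ E, z ∈ e) → (∃ e ∈ N, z ∈ e) → z = s ∨ z = t) → s(x, y) ∈ E → IsTTSP (E ∪ N) x y := by
  induction hE with
  | @edge s t hst =>
    intro N x y hN hd hV hxy
    rw [Finset.mem_singleton] at hxy
    have key : IsTTSP ({s(s, t)} ∪ N) s t :=
      IsTTSP.parallel (IsTTSP.edge hst) hN hd fun z hz₁ _ => by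
        obtain ⟨e, he, hze⟩ := hz₁
        rw [Finset.mem_singleton] at he; subst he
        exact Sym2.mem_iff.1 hze
    rcases Sym2.eq_iff.1 hxy with ⟨rfl, rfl⟩ | ⟨rfl, rfl⟩
    · exact key
    · exact key.symm
  | @series E₁ E₂ a m b h₁ h₂ hd₁₂ hV₁₂ ha hb ih₁ ih₂ =>
    intro N x y hN hd hV hxy
    have hdN₁ : Disjoint E₁ N := Finset.disjoint_of_subset_left Finset.subset_union_left hd
    have hdN₂ : Disjoint E₂ N := Finset.disjoint_of_subset_left Finset.subset_union_right hd
    have ham : a ≠ m := h₁.ne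
    have hbm : b ≠ m := by
      obtain ⟨e, he, hme⟩ := h₁.right_mem
      intro hbm; exact hb e he (hbm ▸ hme)
    -- `m` is off `N`
    have hmN : ∀ e ∈ N, m ∉ e := by
      intro e he hme
      obtain ⟨e₁, he₁, hme₁⟩ := h₁.right_mem
      rcases hV m ⟨e₁, Finset.mem_union_left _ he₁, hme₁⟩ ⟨e, he, hme⟩ with h | h
      · exact ham h.symm
      · exact hbm h.symm
    rcases Finset.mem_union.1 hxy with hxy | hxy
    · -- the edge lies in `E₁`: go around through `E₂ ∘ N⁻¹` (a network between `m` and `a`)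
      have hN₁ : IsTTSP (E₂ ∪ N) m a := by
        refine IsTTSP.series h₂ hN.symm hdN₂ (fun z hz₂ hzN => ?_) hmN ha
        obtain ⟨e₂, he₂, hze₂⟩ := hz₂
        rcases hV z ⟨e₂, Finset.mem_union_right _ he₂, hze₂⟩ hzN with h | h
        · exact absurd hze₂ (h ▸ ha e₂ he₂)
        · exact h
      have key := ih₁ hN₁.symm (Finset.disjoint_union_right.2 ⟨hd₁₂, hdN₁⟩) (fun z hz₁ hz => ?_) hxy
      · rw [Finset.union_assoc]; exact key
      · rcases span_union hz with hz | hz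
        · exact Or.inr (hV₁₂ z hz₁ hz)
        · rcases hV z (by obtain ⟨e, he, hze⟩ := hz₁; exact ⟨e, Finset.mem_union_left _ he, hze⟩) hz with h | h
          · exact Or.inl h
          · obtain ⟨e, he, hze⟩ := hz₁
            exact absurd hze (h ▸ hb e he)
    · -- the edge lies in `E₂`: go around through `N⁻¹ ∘ E₁` (a network between `b` and `m`)
      have hN₂ : IsTTSP (N ∪ E₁) b m := by
        refine IsTTSP.series hN.symm h₁ hdN₁.symm (fun z hzN hz₁ => ?_) hb (fun e he hme => hmN e he hme)
        obtain ⟨e₁, he₁, hze₁⟩ := hz₁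
        rcases hV z ⟨e₁, Finset.mem_union_left _ he₁, hze₁⟩ hzN with h | h
        · exact h
        · exact absurd hze₁ (h ▸ hb e₁ he₁)
      have key := ih₂ hN₂.symm (Finset.disjoint_union_right.2 ⟨hdN₂, hd₁₂.symm⟩) (fun z hz₂ hz => ?_) hxy
      · have hset : E₂ ∪ (N ∪ E₁) = E₁ ∪ E₂ ∪ N := by
          ext g; simp only [Finset.mem_union]; tauto
        rw [hset] at key; exact key
      · rcases span_union hz with hz | hz
        · rcases hV z (by obtain ⟨e, he, hze⟩ := hz₂; exact ⟨e, Finset.mem_union_right _ he, hze⟩) hz with h | h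
          · obtain ⟨e, he, hze⟩ := hz₂
            exact absurd hze (h ▸ ha e he)
          · exact Or.inr h
        · exact Or.inl (hV₁₂ z hz hz₂)
  | @parallel E₁ E₂ s t h₁ h₂ hd₁₂ hV₁₂ ih₁ ih₂ =>
    intro N x y hN hd hV hxy
    have hdN₁ : Disjoint E₁ N := Finset.disjoint_of_subset_left Finset.subset_union_left hd
    have hdN₂ : Disjoint E₂ N := Finset.disjoint_of_subset_left Finset.subset_union_right hd
    rcases Finset.mem_union.1 hxy with hxy | hxy
    · have hN₁ : IsTTSP (E₂ ∪ N) s t :=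
        IsTTSP.parallel h₂ hN hdN₂ fun z hz₂ hzN =>
          hV z (by obtain ⟨e, he, hze⟩ := hz₂; exact ⟨e, Finset.mem_union_right _ he, hze⟩) hzN
      have key := ih₁ hN₁ (Finset.disjoint_union_right.2 ⟨hd₁₂, hdN₁⟩) (fun z hz₁ hz => ?_) hxy
      · rw [Finset.union_assoc]; exact key
      · rcases span_union hz with hz | hz
        · exact hV₁₂ z hz₁ hz
        · exact hV z (by obtain ⟨e, he, hze⟩ := hz₁; exact ⟨e, Finset.mem_union_left _ he, hze⟩) hz
    · have hN₂ : IsTTSP (E₁ ∪ N) s t :=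
        IsTTSP.parallel h₁ hN hdN₁ fun z hz₁ hzN =>
          hV z (by obtain ⟨e, he, hze⟩ := hz₁; exact ⟨e, Finset.mem_union_left _ he, hze⟩) hzN
      have key := ih₂ hN₂ (Finset.disjoint_union_right.2 ⟨hd₁₂.symm, hdN₂⟩) (fun z hz₂ hz => ?_) hxy
      · have hset : E₂ ∪ (E₁ ∪ N) = E₁ ∪ E₂ ∪ N := by
          ext g; simp only [Finset.mem_union]; tauto
        rw [hset] at key; exact key
      · rcases span_union hz with hz | hz
        · exact (hV₁₂ z hz hz₂)
        · exact hV z (by obtain ⟨e, he, hze⟩ := hz₂; exact ⟨e, Finset.mem_union_right _ he, hze⟩) hz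

/-- **Re-rooting when the terminal edge lies inside**: if `st ∈ E`, then for every edge `xy ∈ E` and every (possibly empty) TTSP network
`N` across the terminals, `E ∪ N` is TTSP between `x` and `y`. [folklore] -/
theorem IsTTSP.reroot_of_mem {E : Finset (Sym2 V)} {s t : V} (hE : IsTTSP E s t) :
    s(s, t) ∈ E → ∀ {N : Finset (Sym2 V)} {x y : V}, (N = ∅ ∨ IsTTSP N s t) → Disjoint E N →
      (∀ z : V, (∃ e ∈ E, z ∈ e) → (∃ e ∈ N, z ∈ e) → z = s ∨ z = t) → s(x, y) ∈ E → IsTTSP (E ∪ N) x y := by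
  induction hE with
  | @edge s t hst =>
    intro _ N x y hN hd hV hxy
    rcases hN with rfl | hN
    · rw [Finset.union_empty]
      rw [Finset.mem_singleton] at hxy
      rcases Sym2.eq_iff.1 hxy with ⟨rfl, rfl⟩ | ⟨rfl, rfl⟩
      · exact IsTTSP.edge hst
      · exact (IsTTSP.edge hst).symm
    · exact (IsTTSP.edge hst).reroot hN hd hV hxy
  | @series E₁ E₂ a m b h₁ h₂ _ _ ha hb _ _ =>
    -- the terminal edge `ab` cannot lie in a series composition
    intro hab
    exfalso
    rcases Finset.mem_union.1 hab with h | h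
    · exact hb _ h (Sym2.mem_mk_right a b)
    · exact ha _ h (Sym2.mem_mk_left a b)
  | @parallel E₁ E₂ s t h₁ h₂ hd₁₂ hV₁₂ ih₁ ih₂ =>
    intro hst N x y hN hd hV hxy
    have hdN₁ : Disjoint E₁ N := Finset.disjoint_of_subset_left Finset.subset_union_left hd
    have hdN₂ : Disjoint E₂ N := Finset.disjoint_of_subset_left Finset.subset_union_right hd
    have hV₁N : ∀ z : V, (∃ e ∈ E₁, z ∈ e) → (∃ e ∈ N, z ∈ e) → z = s ∨ z = t := fun z hz₁ hzN =>
      hV z (by obtain ⟨e, he, hze⟩ := hz₁; exact ⟨e, Finset.mem_union_left _ he, hze⟩) hzN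
    have hV₂N : ∀ z : V, (∃ e ∈ E₂, z ∈ e) → (∃ e ∈ N, z ∈ e) → z = s ∨ z = t := fun z hz₂ hzN =>
      hV z (by obtain ⟨e, he, hze⟩ := hz₂; exact ⟨e, Finset.mem_union_right _ he, hze⟩) hzN
    -- the completed siblings `E₂ ∪ N`, `E₁ ∪ N` are TTSP between `s` and `t`
    have hN₁ : IsTTSP (E₂ ∪ N) s t := by
      rcases hN with rfl | hN
      · rw [Finset.union_empty]; exact h₂
      · exact IsTTSP.parallel h₂ hN hdN₂ hV₂N
    have hN₂ : IsTTSP (E₁ ∪ N) s t := by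
      rcases hN with rfl | hN
      · rw [Finset.union_empty]; exact h₁
      · exact IsTTSP.parallel h₁ hN hdN₁ hV₁N
    have hsep₁ : ∀ z : V, (∃ e ∈ E₁, z ∈ e) → (∃ e ∈ E₂ ∪ N, z ∈ e) → z = s ∨ z = t := fun z hz₁ hz => by
      rcases span_union hz with hz | hz
      · exact hV₁₂ z hz₁ hz
      · exact hV₁N z hz₁ hz
    have hsep₂ : ∀ z : V, (∃ e ∈ E₂, z ∈ e) → (∃ e ∈ E₁ ∪ N, z ∈ e) → z = s ∨ z = t := fun z hz₂ hz => by
      rcases span_union hz with hz | hz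
      · exact hV₁₂ z hz hz₂
      · exact hV₂N z hz₂ hz
    have hset : E₂ ∪ (E₁ ∪ N) = E₁ ∪ E₂ ∪ N := by
      ext g; simp only [Finset.mem_union]; tauto
    rcases Finset.mem_union.1 hxy with hxy | hxy
    · rcases Finset.mem_union.1 hst with hst | hst
      · have key := ih₁ hst (Or.inr hN₁) (Finset.disjoint_union_right.2 ⟨hd₁₂, hdN₁⟩) hsep₁ hxy
        rw [Finset.union_assoc]; exact key
      · have key := h₁.reroot hN₁ (Finset.disjoint_union_right.2 ⟨hd₁₂, hdN₁⟩) hsep₁ hxy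
        rw [Finset.union_assoc]; exact key
    · rcases Finset.mem_union.1 hst with hst | hst
      · have key := h₂.reroot hN₂ (Finset.disjoint_union_right.2 ⟨hd₁₂.symm, hdN₂⟩) hsep₂ hxy
        rw [hset] at key; exact key
      · have key := ih₂ hst (Or.inr hN₂) (Finset.disjoint_union_right.2 ⟨hd₁₂.symm, hdN₂⟩) hsep₂ hxy
        rw [hset] at key; exact key

/-- **The terminal-edge completion is TTSP at every edge**: `E` TTSP between `s, t` and `xy ∈ E ∪ {st}` ⇒ `E ∪ {st}` is TTSP between `x`
and `y` (Duffin 1965: a 2-connected series–parallel graph can be decomposed from any of its edges). [folklore] -/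
theorem IsTTSP.insert_edge_of_mem {E : Finset (Sym2 V)} {s t x y : V} (hE : IsTTSP E s t) (hxy : s(x, y) ∈ insert s(s, t) E) :
    IsTTSP (insert s(s, t) E) x y := by
  by_cases hst : s(s, t) ∈ E
  · rw [Finset.insert_eq_of_mem hst]
    rw [Finset.insert_eq_of_mem hst] at hxy
    have key := hE.reroot_of_mem hst (N := ∅) (Or.inl rfl) (Finset.disjoint_empty_right _) (fun z _ hz => by
      obtain ⟨e, he, _⟩ := hz; exact absurd he (Finset.notMem_empty _)) hxy
    rw [Finset.union_empty] at key; exact key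
  · rcases Finset.mem_insert.1 hxy with hxy | hxy
    · have key := hE.insert_edge hst
      rcases Sym2.eq_iff.1 hxy with ⟨rfl, rfl⟩ | ⟨rfl, rfl⟩
      · exact key
      · exact key.symm
    · have key := hE.reroot (IsTTSP.edge hE.ne) (Finset.disjoint_singleton_right.2 hst) (fun z _ hz => by
        obtain ⟨e, he, hze⟩ := hz
        rw [Finset.mem_singleton] at he; subst he
        exact Sym2.mem_iff.1 hze) hxy
      rw [Finset.insert_eq, Finset.union_comm]; exact key

end Reroot

/-! ### Wagner's theorem for all pairs of a completed two-terminal series–parallel support -/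

section AllPairs

variable [Fintype V]

omit [Fintype V] in
/-- Edges of a two-terminal series–parallel network are not loops. [folklore] -/
theorem IsTTSP.not_isDiag {E : Finset (Sym2 V)} {s t : V} (hE : IsTTSP E s t) : ∀ {e : Sym2 V}, e ∈ E → ¬ e.IsDiag := by
  induction hE with
  | edge hst => intro e he; rw [Finset.mem_singleton] at he; subst he; rw [Sym2.mk_isDiag_iff]; exact hst
  | series _ _ _ _ _ _ ih₁ ih₂ =>
    intro e he; rcases Finset.mem_union.1 he with he | he
    · exact ih₁ he
    · exact ih₂ he
  | parallel _ _ _ _ ih₁ ih₂ =>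
    intro e he; rcases Finset.mem_union.1 he with he | he
    · exact ih₁ he
    · exact ih₂ he

/-- **EC⁺ at every edge of a completed two-terminal series–parallel support, every `q > 0`**: `E` TTSP between `s, t`, `w` supported in
`E ∪ {st}`, `xy ∈ E ∪ {st}`, `f` fractional ⇒ `φ_{w[f↦0],q}(x ↔ y) ≤ φ_{w[f↦1],q}(x ↔ y)`. [cite: Wagner2006, Thm. 5.8(d), §5.3] [cite: Grimmett2006, Thm. (3.21); §3.9 (p. 63)] -/
theorem edgeConnMono_of_isTTSP_mem {q : ℝ} (hq : 0 < q) {E : Finset (Sym2 V)} {s t x y : V} (hE : IsTTSP E s t)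
    (hxy : s(x, y) ∈ insert s(s, t) E) (w : Sym2 V → unitInterval)
    (hw : ∀ e, ((w e : unitInterval) : ℝ) ≠ 0 → e ∈ (↑(insert s(s, t) E) : Set (Sym2 V))) (f : Sym2 V)
    (hf0 : 0 < ((w f : unitInterval) : ℝ)) (hf1 : ((w f : unitInterval) : ℝ) < 1) :
    (rcMeasureW (Function.update w f 0) q ∅).real (openConn x y) ≤
      (rcMeasureW (Function.update w f 1) q ∅).real (openConn x y) :=
  edgeConnMono_of_isTTSP hq (hE.insert_edge_of_mem hxy) w hw f hf0 hf1

/-- **Wagner's theorem, all pairs** (`0 < q < 1`): if `E` is a two-terminal series–parallel network between `s` and `t` and `w` is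
supported in `E ∪ {st}` (a 2-connected series–parallel support presented from one of its edges), then `φ_{w,q}` is EDGE-NEGATIVELY
ASSOCIATED: `φ(J_e ∩ J_f) ≤ φ(J_e)·φ(J_f)` for every non-loop pair `e` and every pair `f ≠ e` — the hypothesis `hNC` of
`FK.pairConnPosUnder_of_edgeNegCorr_on` on the support `E ∪ {st}`, and the named fact `Wagner2008_rc_edgeNegCorr_of_noK4Minor` with
'`K₄`-minor-free' replaced by this presentation.  UNCONDITIONAL. [cite: Wagner2006, Ex. 5.1, Thm. 5.8(d), §5.3] [cite: Grimmett2006, §3.9 eq. (3.94) (pp. 63–64)] -/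
theorem edgeNegCorr_supp_of_isTTSP {q : ℝ} (hq0 : 0 < q) (hq1 : q < 1) {E : Finset (Sym2 V)} {s t : V} (hE : IsTTSP E s t)
    (w : Sym2 V → unitInterval) (hw : ∀ e, ((w e : unitInterval) : ℝ) ≠ 0 → e ∈ (↑(insert s(s, t) E) : Set (Sym2 V)))
    (e f : Sym2 V) (he : ¬ e.IsDiag) (hfe : f ≠ e) :
    (rcMeasureW w q ∅).real ({ω | e ∈ ω} ∩ {ω | f ∈ ω}) ≤
      (rcMeasureW w q ∅).real {ω | e ∈ ω} * (rcMeasureW w q ∅).real {ω | f ∈ ω} := by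
  by_cases hwe : ((w e : unitInterval) : ℝ) = 0
  · -- a pair of parameter `0` is almost surely closed
    have h0 : (rcMeasureW w q ∅).real ({ω | e ∈ ω} ∩ {ω | f ∈ ω}) = 0 := by
      rw [rcMeasureW_real_eq_sum_div w hq0 ∅, sum_rcWeightW_ind_inter_openPair_of_zero w q hwe, zero_div]
    rw [h0]
    exact mul_nonneg measureReal_nonneg measureReal_nonneg
  · have heE : e ∈ insert s(s, t) E := hw e hwe
    induction e using Sym2.ind with
    | h x y => exact edgeNegCorr_of_isTTSP hq0 hq1 (hE.insert_edge_of_mem heE) w hw f hfe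

/-- **Wagner's full range `0 < q ≤ 1`, all pairs**: as `FK.edgeNegCorr_supp_of_isTTSP`, with equality at `q = 1` (product measure).
[cite: Wagner2006, Ex. 5.1, Thm. 5.8(d), §5.3] [cite: Grimmett2006, §3.9 eq. (3.94) (pp. 63–64); §1.3] -/
theorem edgeNegCorr_supp_of_isTTSP_of_le_one {q : ℝ} (hq0 : 0 < q) (hq1 : q ≤ 1) {E : Finset (Sym2 V)} {s t : V}
    (hE : IsTTSP E s t) (w : Sym2 V → unitInterval)
    (hw : ∀ e, ((w e : unitInterval) : ℝ) ≠ 0 → e ∈ (↑(insert s(s, t) E) : Set (Sym2 V))) (e f : Sym2 V) (he : ¬ e.IsDiag)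
    (hfe : f ≠ e) :
    (rcMeasureW w q ∅).real ({ω | e ∈ ω} ∩ {ω | f ∈ ω}) ≤
      (rcMeasureW w q ∅).real {ω | e ∈ ω} * (rcMeasureW w q ∅).real {ω | f ∈ ω} := by
  rcases hq1.lt_or_eq with hlt | heq
  · exact edgeNegCorr_supp_of_isTTSP hq0 hlt hE w hw e f he hfe
  · subst heq
    rw [rcMeasureW_one]
    have hdet : ∀ g : Sym2 V, DeterminedBy ({ω | g ∈ ω} : Set (BondConfig V)) (↑({g} : Finset (Sym2 V)) : Set (Sym2 V)) := by
      intro g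
      rw [determinedBy_iff]
      intro ω ω' h
      rw [Finset.coe_singleton] at h
      constructor
      · intro hg
        have : g ∈ ω' ∩ {g} := h ▸ ⟨hg, rfl⟩
        exact this.1
      · intro hg
        have : g ∈ ω ∩ {g} := h.symm ▸ ⟨hg, rfl⟩
        exact this.1
    rw [prodBernoulli_real_inter_of_determinedBy_disjoint w (Finset.disjoint_singleton.2 hfe.symm) (hdet e) (hdet f)
      (measurableSet_mem _) (measurableSet_mem _)]

end AllPairs

end FK

end Summit.CriticalPhenomena.PercolationContinuityZ3.Theorems

end
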